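/-
Copyright: the b2b-balaban cell (near-miss cell 7), T⁴-continuum fan-out, lineage t4-ne7b-p3 (node U5c LARGE-DEVIATION
member P3).  Released under the licence of the surrounding project.
-/
import Summits.QuantumFields.BalabanUV.T4Continuum.Support.SpaceTimeRealisedM
import Summits.QuantumFields.BalabanUV.T4Continuum.Support.SpaceTimeRealisedLinWitness

/-!
# Space-time Peierls ∕ Cramér route for NE7b — NON-VACUITY of the separation-free junction `RLin.lineageReadingsM`

Summits-side support leaf of the T⁴-continuum cell (rung (B)+1 on a FINITE torus only; NOT infinite volume, NOT the
mass gap, NOT the Clay statement; NOT a proof of the spine estimate NE7b).  Lineage `t4-ne7b-p3` (generation 3), node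
U5c, skeleton `t4/skeletons/NE7b-t4-ne7b-p3.md` §15.  [folklore] sanity over `SpaceTimeRealisedM` with the toy of
`SpaceTimeRealisedLinWitness` (`toyR`, `P₀`, `realises_toy`, `pendingAt_toy`); numerals never enter the route; nothing
printed is asserted; no `[cite:]` tag.

WHAT.  **`lineageReadingsM_witnessR`**: for ANY printed-shape constants with `n₁ ≥ 13`, any genealogy cutoff, any sizes
`R ≥ 1` and any couplings, every hypothesis of `RLin.lineageReadingsM` — the flow side conditions, (i), (ii′), (iv‴)
`Realises ∧ PendingAt`, the MEMBER factorisation (v⁗) (with the weight `min (e^{−(credits − lifeCost)(toGenT 0 P₀)}) 1`,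
valid whether or not the single lineage is a member of the contour), (vi) with remainder `1` — is discharged on the toy,
giving `LineageReadingsM` with the NONEMPTY bad class `{τ₀}` and a POSITIVE weight.  No separation hypothesis exists to
discharge.

HONEST DEPENDENCY (cell, verbatim): continuum YM on T⁴ ⇐ BetaPertH ∧ nine spine estimates (0/9 proved); BetaPertH ⇐
(D1) ∧ (D4) ∧ CAP+tail; G-an2-4 gates asym, D1 and NE2/3/4.  This file changes none of it.
-/

open Finset

namespace Summit.QuantumFields.BalabanUV.T4Continuum.SpaceTimePeierls

open Literature.MathematicalPhysics.QuantumFieldTheory.Balaban1983to89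
open Literature.MathematicalPhysics.QuantumFieldTheory.Balaban1983to89.B16SProfile
open T4PersistenceDictionary T4BankedInduction T4PrintedShapeBanking
open T4TaggedShapeBanking (dictWT costT)
open Summit.QuantumFields.BalabanUV.T4Continuum.HistoryAdmissible
open Summit.QuantumFields.BalabanUV.T4Continuum.HistoryRealise
open SpaceTimePeierlsLeaves WitnessR

noncomputable section

open Classical

/-- **NON-VACUITY OF `RLin.lineageReadingsM`.**  On the toy realised data `toyR` every hypothesis of the separation-free
junction is discharged, with bad class `{τ₀}` and the weight `A τ₀ = min (e^{−(credits − lifeCost)(toGenT 0 P₀)}) 1 > 0`.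
[folklore] -/
theorem lineageReadingsM_witnessR (C : T4PrintedShapeBanking.Consts) (hn₁ : 13 ≤ C.n₁) (Kc : ℕ) (R : ℕ → ℕ)
    (hR : ∀ t, 1 ≤ R t) (g : ℕ → ℝ) :
    ∃ (A : Unit → ℝ) (Bad : Finset Unit), Bad.Nonempty ∧ (∀ τ ∈ Bad, 0 < A τ) ∧
      LineageReadingsM toyR.toLinDataT.model (fun lam => toGenT 0 (toyR.P lam)) C 0 Kc R g A Bad 0 1
        (3 ^ 1 + 4 ^ (2 * 1) + 1) ((((3 ^ 1 + 4 ^ (2 * 1) + 1 : ℕ) : ℝ) + 1) ^ 2) (((1 * 4 ^ (0 - 0)) ^ 1 : ℕ) : ℝ)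
        (8 * 126 ^ 1) (126 ^ 1) ((127 : ℝ) ^ 1 + 3) 0 := by
  set S : ℝ := credits (credit C g ∘ Prod.snd) (toGenT 0 P₀) -
    lifeCost (dictWT Prod.snd R C.n₁) (costT Prod.snd C Kc R) (toGenT 0 P₀) with hS
  set A : Unit → ℝ := fun _ => min (Real.exp (-S)) 1 with hA
  refine ⟨A, {()}, ⟨(), mem_singleton_self _⟩, fun τ _ => lt_min (Real.exp_pos _) one_pos, ?_⟩
  refine toyR.lineageReadingsM (rest := fun _ _ => 1) (by norm_num) le_rfl (fun u => Nat.le_succ u)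
    (fun u => by omega) (fun u => ?_) (fun m => B16Absorption.dropCtl_const 0 m) hR hn₁ (Nat.zero_le _)
    (fun τ _ => (lt_min (Real.exp_pos _) one_pos).le) (subset_refl _) le_rfl (fun τ _ => ?_)
    (fun τ _ lam _ => ?_) (fun 𝒦 τ _ _ => ?_) (fun _ τ _ => zero_le_one) (fun 𝒦 => ?_)
  · -- the flow: `ratio 4 0 u = 4 = 4^{(u+1) − u}`
    show ratio 4 (fun _ => 0) u = 4 ^ (u + 1 - u)
    simp [ratio, qexp]
  · -- (ii′) the bad term's lineage is rooted at step `0`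
    exact ⟨(), mem_singleton_self _, le_rfl⟩
  · -- (iv‴) realised and pending — nothing else
    cases lam
    exact ⟨realises_toy R, pendingAt_toy R⟩
  · -- (v⁗) member factorisation: the members are `∅` or `{()}`
    rw [mul_one]
    have hsub : toyR.members τ 𝒦 ⊆ ({()} : Finset Unit) := fun x _ => by cases x; exact mem_singleton_self _
    rcases subset_singleton_iff.1 hsub with h | h
    · rw [h, sum_empty, neg_zero, Real.exp_zero]
      exact min_le_right _ _
    · rw [h, sum_singleton]
      exact min_le_left _ _
  · -- (vi) remainder: one term, `rest = 1`, `c₃ = 0`, `nup = 1`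
    rw [Real.exp_zero, one_pow, one_mul]
    calc ∑ τ ∈ toyR.toLinDataT.model.T.filter (fun τ => toyR.toLinDataT.model.IsContour τ 𝒦), (1 : ℝ)
        ≤ ∑ τ ∈ toyR.toLinDataT.model.T, (1 : ℝ) :=
          sum_le_sum_of_subset_of_nonneg (filter_subset _ _) fun _ _ _ => zero_le_one
      _ = 1 := by
          show ∑ τ ∈ ({()} : Finset Unit), (1 : ℝ) = 1
          simp

end

end Summit.QuantumFields.BalabanUV.T4Continuum.SpaceTimePeierls
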